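/-
Copyright (c) 2026 the pub-hodgecm-mathlib formalisation cell (harness21).  Prover seat hodgecm-mathlib-K2Liu-p08 (g6), Track B «K2-LIT»,
#184♮ = hLiu418 = `stmt-HodgeConjecture-24832`; #42S BLOCK D, row D-2, (σ-A) mini-road (desk K2Liu-p25 WORD #51 «(an-3c) §3b cut», piece (D)-pre):
THE ζ-STAGE HAAR TRANSPORT — the ζ-integral over `E_w` of ★ `chainValues_of_placeLetter` (e′) read over `(L⁺_v)²` in the quadratic coordinates `ζ = ι a + ι b·δ`.
THEOREMS ONLY (no `def`, no `instance`, no `notation`, no named-fact hypothesis, no `sorry`, default heartbeats).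
-/
import Summits.HodgeConjecture.HodgeConjecture.Theorems.K2LiuLocalRingPlaceDecomposition   -- ★ (R2) `exists_homeomorph_single_of_forall_eq`, (R4) `exists_addHaar_eq_smul_map`
import Literature.NumberTheory.Automorphic.AdicCompletionLocalField                         -- ★ instances `ValuativeRel ∕ IsNonarchimedeanLocalField (v.adicCompletion F)`
import Literature.NumberTheory.Automorphic.TateLocalZetaShells                              -- ★ `secondCountableTopology_localField`
import HarnessLib

/-!
# Crux `HLiu418`, #42S BLOCK D, row D-2, (σ-A) brick (an-3c) §3b, piece (D)-pre: THE ζ-STAGE HAAR TRANSPORT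
# `∫_{E_w} f(ζ·e_w) dμ_w(ζ) = c_H · ∫_{(L⁺_v)²} f(ι ζ′₀ + ι ζ′₁·δ) dμ^{⊗2}(ζ′)`

Cell `hodgecm-mathlib`, crux item hLiu418 = `stmt-HodgeConjecture-24832`; squad K2 ∕ K2Liu; prover K2Liu-p08 (g6).  Lane `--supports stmt-HodgeConjecture-24832
--as helper` (count-neutral helper; closes no socket).

WHY.  Letter (L1) of ★ p864562 `coneWord_of_stageLetters` reads `N₂val x = c_E · ∫ N₁ x ζ′ dμ^κ(ζ′)` with `κ = Fin 2` and `μ^κ` the product Haar measure on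
`(L⁺_v)²`, while the ζ-stage of ★ `chainValues_of_placeLetter` (e′)∕★ `chainValues_half_of_placeLetter` (g)(h) integrates over the completion `E_w`
(`w` the ONE place above a non-split `v`) against a Haar measure `μ_w`, the variable entering through `Pi.single w ζ ∈ E ⊗ F_v` (`φ(u_−(ζ e_w))`).  At a non-split place
`ζ ↦ Pi.single w ζ` is an additive homeomorphism `E_w ≃ₜ E ⊗ F_v` (★ (R2)), `E ⊗ F_v ≃L (F_v)²` by the quadratic coordinates `ι a + ι b·δ ↤ (a, b)`
(★ `quadraticLocalEquiv`), and `(F_v)² ≃ₜ (Fin 2 → F_v)`; Haar measures along an additive homeomorphism are proportional (★ (R4) `exists_addHaar_eq_smul_map`), so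
**`∫ f(Pi.single w ζ) dμ_w(ζ) = c_H · ∫ f(quadraticLocalEquiv (ζ′ 0, ζ′ 1)) dμ^{⊗2}(ζ′)`** for EVERY `f : E ⊗ F_v → G` with ONE `0 < c_H` (no integrability needed:
both sides are `0` together off `L¹`).  (D) `K2LiuStageFunctionalConeWordRecord` applies it to `f := ζ_loc ↦ ∫_y F_Φ(…·φ(u_−(ζ_loc))·…) dμ`.
HONEST LABEL.  `HC_CM` is proved only modulo the 7 printed citations (2 remaining named inputs: hLiu418 = `stmt-HodgeConjecture-24832`,
h413 = `stmt-HodgeConjecture-24833`) until rung 0 closes; count-neutral helper, closes no socket.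

## References
* [Weil1965] A. Weil, *L'intégration dans les groupes topologiques* (1965), §37 (Haar measures along an isomorphism are proportional).
* [CasselsFrohlichANT1967] J. W. S. Cassels, A. Fröhlich (eds.), *Algebraic Number Theory* (1967), Ch. II §10–§11 (`E ⊗_F F_v = ∏_{w ∣ v} E_w`).
* [TateThesis1967] J. Tate, *Fourier analysis in number fields* (Cassels–Fröhlich Ch. XV), §2.2.
-/

set_option autoImplicit false
set_option linter.dupNamespace false -- the mandated namespace repeats `HodgeConjecture.HodgeConjecture`

noncomputable section

open NumberField IsDedekindDomain MeasureTheory Topology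
open scoped NNReal ENNReal
open Literature.NumberTheory.Automorphic Literature.NumberTheory.Automorphic.UnitaryGroup
open Literature.NumberTheory.GaloisRepresentations Literature.NumberTheory.GaloisRepresentations.IsNonarchimedeanLocalField
open Summit.HodgeConjecture.HodgeConjecture.Cruxes.HLiu418.K2LiuLocalRingPlaceDecomposition

namespace Summit.HodgeConjecture.HodgeConjecture.Cruxes.HLiu418.K2LiuConeZetaTransport

variable {F : Type} [Field F] [NumberField F] (E : Type) [Field E] [NumberField E] [Algebra F E] [Algebra.IsQuadraticExtension F E]
  (c : E ≃ₐ[F] E) {δ : E} (hcδ : c δ = -δ) (hδ : δ ≠ 0) (v : HeightOneSpectrum (𝓞 F))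

/-- **THE ζ-STAGE HAAR TRANSPORT.**  At a non-split place (`w` the only place of `E` above `v`), for Haar measures `μ_w` on `E_w` and `μ` on `F_v` there is ONE
`0 < c_H` with, for EVERY `f : E ⊗ F_v → G`: `∫ f(Pi.single w ζ) dμ_w(ζ) = c_H · ∫ f(ι(ζ′ 0) + ι(ζ′ 1)·δ) dμ^{⊗ Fin 2}(ζ′)` — ★ (R2) (`Pi.single w` is an additive
homeomorphism), ★ `quadraticLocalEquiv`, `(F_v)² ≃ₜ F_v^{Fin 2}`, ★ (R4) (Haar measures along an additive homeomorphism are proportional), `integral_map_equiv`.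
[cite: Weil1965, §37] [cite: CasselsFrohlichANT1967, Ch. II §10–§11] -/
theorem exists_integral_single_eq_mul_integral_pi [DecidableEq (PlacesOver E v)] (w : PlacesOver E v) (hw : ∀ w' : PlacesOver E v, w' = w)
    [MeasurableSpace (v.adicCompletion F)] [BorelSpace (v.adicCompletion F)] (μ : Measure (v.adicCompletion F)) [μ.IsAddHaarMeasure]
    [MeasurableSpace (w.1.adicCompletion E)] [BorelSpace (w.1.adicCompletion E)] (μw : Measure (w.1.adicCompletion E)) [μw.IsAddHaarMeasure]
    {G : Type*} [NormedAddCommGroup G] [NormedSpace ℝ G] :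
    ∃ cH : ℝ, 0 < cH ∧ ∀ f : UnitaryGroup.LocalRing E v → G,
      ∫ ζ, f (Pi.single w ζ) ∂μw =
        cH • ∫ ζ' : Fin 2 → v.adicCompletion F, f (quadraticLocalEquiv E v c hcδ hδ (ζ' 0, ζ' 1)) ∂(Measure.pi fun _ : Fin 2 => μ) := by
  haveI : SecondCountableTopology (v.adicCompletion F) := secondCountableTopology_localField (v.adicCompletion F)
  -- the additive homeomorphism `E_w ≃ₜ (Fin 2 → F_v)`
  obtain ⟨e₁, he₁, he₁add⟩ := exists_homeomorph_single_of_forall_eq F E v w hw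
  let e₂ : UnitaryGroup.LocalRing E v ≃ₜ (v.adicCompletion F × v.adicCompletion F) := (quadraticLocalEquiv E v c hcδ hδ).toHomeomorph.symm
  let e₃ : (v.adicCompletion F × v.adicCompletion F) ≃ₜ (Fin 2 → v.adicCompletion F) := (Homeomorph.finTwoArrow (X := v.adicCompletion F)).symm
  let e : w.1.adicCompletion E ≃ₜ (Fin 2 → v.adicCompletion F) := e₁.trans (e₂.trans e₃)
  have he₂add : ∀ p p' : UnitaryGroup.LocalRing E v, e₂ (p + p') = e₂ p + e₂ p' := fun p p' =>
    map_add (quadraticLocalEquiv E v c hcδ hδ).symm p p'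
  have he₃add : ∀ p p' : v.adicCompletion F × v.adicCompletion F, e₃ (p + p') = e₃ p + e₃ p' := fun p p' => by
    funext i
    fin_cases i <;> rfl
  have hadd : ∀ p p' : w.1.adicCompletion E, e (p + p') = e p + e p' := fun p p' => by
    show e₃ (e₂ (e₁ (p + p'))) = e₃ (e₂ (e₁ p)) + e₃ (e₂ (e₁ p'))
    rw [he₁add, he₂add, he₃add]
  -- the read-back of `e`: the quadratic coordinates of `e ζ` glue to `Pi.single w ζ`
  have hback : ∀ ζ : w.1.adicCompletion E, quadraticLocalEquiv E v c hcδ hδ ((e ζ) 0, (e ζ) 1) = Pi.single w ζ := fun ζ => by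
    have h3 : ((e ζ) 0, (e ζ) 1) = e₂ (e₁ ζ) := by
      show Homeomorph.finTwoArrow (e₃ (e₂ (e₁ ζ))) = e₂ (e₁ ζ)
      exact (Homeomorph.finTwoArrow (X := v.adicCompletion F)).apply_symm_apply _
    rw [h3, ← he₁ ζ]
    exact (quadraticLocalEquiv E v c hcδ hδ).apply_symm_apply _
  -- Haar transport: `μ^{⊗2} = cR • map e μ_w`
  obtain ⟨cR, hcR, hμ⟩ := exists_addHaar_eq_smul_map e hadd μw (Measure.pi fun _ : Fin 2 => μ)
  refine ⟨((cR : ℝ))⁻¹, inv_pos.2 (NNReal.coe_pos.2 hcR), fun f => ?_⟩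
  have hmap : ∫ ζ' : Fin 2 → v.adicCompletion F, f (quadraticLocalEquiv E v c hcδ hδ (ζ' 0, ζ' 1)) ∂(Measure.pi fun _ : Fin 2 => μ) =
      (cR : ℝ) • ∫ ζ, f (Pi.single w ζ) ∂μw := by
    rw [hμ, ← ENNReal.smul_def, integral_smul_nnreal_measure, integral_map_equiv]
    simp only [Homeomorph.toMeasurableEquiv_coe, hback]
    rfl
  rw [hmap, smul_smul, inv_mul_cancel₀ (NNReal.coe_pos.2 hcR).ne', one_smul]

end Summit.HodgeConjecture.HodgeConjecture.Cruxes.HLiu418.K2LiuConeZetaTransport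

end
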